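/-
Copyright (c) 2026 the pub-hodgecm-mathlib formalisation cell (harness21).  Prover seat hodgecm-mathlib-K2E4-p11 (g8): Track B «K2-LIT»,
#184♮ = hLiu418 = stmt-HodgeConjecture-24832; socket #41 open surface (u-0c) — file I4, EDITION 6 «ARCH-ADAPTED DATUM» as a NEW file over ★ ED. 5 p862751:
every datum letter built inside; ONE visible letter, the archimedean Levi-adaptedness of `𝒦`.  THEOREMS ONLY (no `def`, no `instance`, no `notation`,
no named-fact hypothesis, no `sorry`).
-/
import Summits.HodgeConjecture.HodgeConjecture.Theorems.K2LiuSiegelEisensteinMiddleTermOfStandardLevel   -- ★ p862751 (this seat) I4 ED. 5 `exists_middleTerm_package_of_standard_level`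
import Summits.HodgeConjecture.HodgeConjecture.Theorems.K2LiuSiegelMiddleTermDatumLetters               -- ★ p862830 (this seat) `exists_middleTerm_datum`
import Summits.HodgeConjecture.HodgeConjecture.Theorems.K2LiuSiegelMiddleTermPreimageLevel              -- ★ p862786 (K2Liu-p12) `exists_preimageLevel`
import Summits.HodgeConjecture.HodgeConjecture.Theorems.K2LiuSiegelMiddleTermCornerLetters              -- ★ p862873 (K2Liu-p03) `hint_and_hFhol_of_standard'`
import HarnessLib

/-!
# Crux `HLiu418`, socket #41, (u-0c) FILE I4 ED. 6 — `K2LiuSiegelEisensteinMiddleTermOfStandardArch`: THE MIDDLE-CELL TERM PACKAGE OF A STANDARD FAMILY AT AN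
# ARCHIMEDEAN-LEVI-ADAPTED STANDARD DATUM — every datum letter of ★ ED. 5 BUILT INSIDE; ONE visible letter `hadapt`

Cell `hodgecm-mathlib`, crux item hLiu418 = `stmt-HodgeConjecture-24832`; squad K2 ∕ K2Liu (L1, LEAD F0P6-plan (g14)), road `K2_Liu`, socket #41; consumers: the TOP
(K2E5-p17 lineage; ED. 18 «MIDDLE AT THE ARCH-ADAPTED DATUM») ∕ K2E3-typ2's tie.  Lane `--supports stmt-HodgeConjecture-24832 --as helper` (count-neutral helper;
closes no socket by itself).  FRAME `e : Fin (1+1) × Fin 1 ≃ Fin 2` (★ p862873's; the socket's `Fin 2 × Fin 1 ≃ Fin n` after `subst` unifies by `rfl`).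

THE MATHEMATICS [MoeglinWaldspurger1995, II.1.7, IV.1.9], [BorelJacquet1979, §1.1, §4.1], [Tan1999, §1, §4 Prop. 4.8]; RULING M-158j (HYBRID (R-a)+(R-c)).  ★ ED. 5
continues the middle-cell term of a STANDARD family at a STANDARD datum `𝒦` given the datum of ★ α3-2, an open finite-index `KG ≤ K_{GL₂}` with `Λ(KG) ⊆ 𝒦.K`, and the two
analytic letters.  All of these are now theorems of the tree: the datum `g₀ Λ Γ₀ β₁ F` (★ p862830), the analytic letters for EVERY such datum (★ p862873, orientation-free,
all translates), and `KG` from the ARCHIMEDEAN adaptedness alone (★ p862786: the finite part of `KG` is free because `C_f` is open).  So the ONLY input beyond the socket's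
own binders is **`hadapt : ∀ Λ, ‹block equation of the Levi chart› → ∀ k ∈ K_{GL₂}, ((Λ k)_∞, 1) ∈ 𝒦.K`** — Levi-adaptedness AT INFINITY, which holds on the whole
archimedean class of the tree's reference datum `K₉` (LH4-p17 `K2LiuLeviChartArchCompactOfRecord`) and is moved to an ARBITRARY standard `𝒦` by ★ p862794
`continuation_of_archReference` at the level of the full socket.
* §1 HEAD **`exists_middleTerm_package_of_standard_arch`** — ★ ED. 2's four conjuncts at `n = 2`, visible: carrier, `wq hwq`, `hχ hχc`, `𝒦 h𝒦 f hstd hcont`, `hadapt`.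
HONEST LABEL.  Count-neutral helper; it retires nothing by itself: `HC_CM` is proved only modulo the 7 printed citations (2 remaining named inputs:
hLiu418 = `stmt-HodgeConjecture-24832`, h413 = `stmt-HodgeConjecture-24833`) until rung 0 closes.

## References
* [MoeglinWaldspurger1995] C. Mœglin, J.-L. Waldspurger, *Spectral decomposition and Eisenstein series* (1995), II.1.7, IV.1.9.
* [BorelJacquet1979] A. Borel, H. Jacquet, *Automorphic forms and automorphic representations*, Corvallis I (1979), §1.1, §4.1.
* [Tan1999] V. Tan, *Poles of Siegel Eisenstein series on U(n,n)*, Canad. J. Math. 51 (1999), §1 p. 166, §4 Prop. 4.8.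
-/

set_option autoImplicit false
set_option linter.dupNamespace false -- the mandated namespace repeats `HodgeConjecture.HodgeConjecture`

noncomputable section

open scoped Matrix ENNReal NNReal
open NumberField IsDedekindDomain MeasureTheory MeasureTheory.Measure Filter Set Function Topology Metric
open Literature.NumberTheory.Automorphic Literature.NumberTheory.Automorphic.UnitaryGroup Literature.NumberTheory.GaloisRepresentations
open Literature.NumberTheory.GelbartRogawski1991 Literature.NumberTheory.GelbartRogawski1991.GRConstruction
open Literature.NumberTheory.GelbartRogawski1991.AdaptedBlocks
open Literature.NumberTheory.K2Lit.SiegelDoubled Literature.MeasureTheory.Group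
open UnitaryDualPair
open Summit.HodgeConjecture.HodgeConjecture.Cruxes.HLiu418.K2LiuSiegelEisensteinMiddleTermOfStandardLevel (exists_middleTerm_package_of_standard_level)
open Summit.HodgeConjecture.HodgeConjecture.Cruxes.HLiu418.K2LiuSiegelMiddleTermDatumLetters (exists_middleTerm_datum)
open Summit.HodgeConjecture.HodgeConjecture.Cruxes.HLiu418.K2LiuSiegelMiddleTermPreimageLevel (exists_preimageLevel)
open Summit.HodgeConjecture.HodgeConjecture.Cruxes.HLiu418.K2LiuSiegelMiddleTermCornerLetters (hint_and_hFhol_of_standard')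

namespace Summit.HodgeConjecture.HodgeConjecture.Cruxes.HLiu418.K2LiuSiegelEisensteinMiddleTermOfStandardArch

variable (L : Type) [Field L] [NumberField L] [IsCMField L]
variable (e : Fin (1 + 1) × Fin 1 ≃ Fin 2)
  (dV : Fin (1 + 1) → L) (hdV : ∀ i, IsCMField.complexConj L (dV i) = dV i)
  (dW : Fin 1 → L) (hdW : ∀ i, IsCMField.complexConj L (dW i) = dW i)
variable [MeasurableSpace (unipDelta L e dV hdV dW hdW)] [BorelSpace (unipDelta L e dV hdV dW hdW)]

/-! ## §1 HEAD: the middle-cell term package at an archimedean-Levi-adapted standard datum -/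

/-- **(u-0c) I4, ED. 6 — THE MIDDLE-CELL TERM PACKAGE `E₇` OF A STANDARD FAMILY AT AN ARCHIMEDEAN-LEVI-ADAPTED STANDARD DATUM.**  Carrier `νN` (Haar on `N_Δ(𝔸)`), `β` an
`N_Δ(L⁺)`-covering weight with `∫⁻β < ∞`, `β ≤ 𝟙_K`, `K` compact; the rational Weyl presentation `wq`; `χ` unitary and trivial on norms; `f` STANDARD for a STANDARD `𝒦` with
continuous members; and ONE letter `hadapt`: for every Levi chart `Λ` (block equation of ★ α3-2) and every `k ∈ K_{GL₂} = GL₂(𝒪̂_L)·K_∞`, the archimedean component of `Λ k` lies in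
`𝒦.K` (`((Λ k)_∞, 1) ∈ 𝒦.K`): **there is `E₇` with ★ ED. 2's `h7d`, `h7c`, `h7eq` (at `P = {½}`) and `h7g`** — ★ ED. 5 `exists_middleTerm_package_of_standard_level` fed by
★ p862830 `exists_middleTerm_datum` (`g₀ Λ Γ₀ β₁ F`), ★ p862786 `exists_preimageLevel` (`KG hKGo hKGfi hΛK` from `hadapt Λ hΛ`), ★ p862873 `hint_and_hFhol_of_standard'`
(`hint hFhol`). [cite: MoeglinWaldspurger1995, II.1.7, IV.1.9] [cite: BorelJacquet1979, §1.1, §4.1] [cite: Tan1999, §4 Prop. 4.8] -/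
theorem exists_middleTerm_package_of_standard_arch (hdV0 : ∀ i, dV i ≠ 0) (hdW0 : ∀ i, dW i ≠ 0)
    -- the carrier
    (νN : Measure (unipDelta L e dV hdV dW hdW)) [νN.IsHaarMeasure]
    (β : unipDelta L e dV hdV dW hdW → ℝ≥0∞) (hβ : IsCoveringWeight (unipDeltaRat L e dV hdV dW hdW) β) (hβtop : ∫⁻ u, β u ∂νN ≠ ∞)
    {K : Set (unipDelta L e dV hdV dW hdW)} (hK : IsCompact K) (hβK : ∀ u, β u ≤ K.indicator 1 u)
    -- the rational Weyl presentation
    (wq : unipDeltaRat L e dV hdV dW hdW → ratH L e dV hdV dW hdW)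
    (hwq : ∀ ν, ((wq ν : ratH L e dV hdV dW hdW) : HA L e dV hdV dW hdW) =
      weylDelta L e dV hdV dW hdW * ((ν : unipDelta L e dV hdV dW hdW) : HA L e dV hdV dW hdW))
    -- the character and the standard family at a standard datum
    {χ : HeckeCharacter L} (hχ : χ.IsUnitary)
    (hχc : ∀ d : (AdeleRing (𝓞 L) L)ˣ, χ (Units.map (conjAdele (Fp L) L (IsCMField.complexConj L) : AdeleRing (𝓞 L) L →* AdeleRing (𝓞 L) L) d) * χ d = 1)
    (𝒦 : IwasawaDatum L e dV hdV dW hdW) (h𝒦 : 𝒦.IsStd) (f : ℂ → HA L e dV hdV dW hdW → ℂ) (hstd : IsStandardSectionFamily 𝒦 χ f) (hcont : ∀ s : ℂ, Continuous (f s))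
    -- THE ONE LETTER: archimedean Levi-adaptedness of `𝒦`
    (hadapt : ∀ (Λ : GL (Fin 2) (AdeleRing (𝓞 L) L) →* HA L e dV hdV dW hdW),
      (∀ g : GL (Fin 2) (AdeleRing (𝓞 L) L), blk L e dV hdV dW hdW (Λ g) =
        cayR (AdeleRing (𝓞 L) L) (Fin 2) * Matrix.fromBlocks (g : Matrix (Fin 2) (Fin 2) (AdeleRing (𝓞 L) L)) 0 0
          (((gramR L e dV hdV dW hdW).map ((algebraMap L (AdeleRing (𝓞 L) L)).comp (algebraMap (Fp L) L)))⁻¹ *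
            (((g⁻¹ : GL (Fin 2) (AdeleRing (𝓞 L) L)) : Matrix (Fin 2) (Fin 2) (AdeleRing (𝓞 L) L)).map
              (conjAdele (Fp L) L (IsCMField.complexConj L)))ᵀ *
            (gramR L e dV hdV dW hdW).map ((algebraMap L (AdeleRing (𝓞 L) L)).comp (algebraMap (Fp L) L))) *
          cayRinv (AdeleRing (𝓞 L) L) (Fin 2)) →
      ∀ k : ↥(standardMaximalCompactGL 2 L),
        (UnitaryGroup.archToAdelic (Fp L) L (IsCMField.complexConj L) (2 + 2) (hermD L e dV hdV dW hdW)
          (UnitaryGroup.archPart (Fp L) L (IsCMField.complexConj L) (2 + 2) (hermD L e dV hdV dW hdW) (Λ (k : GL (Fin 2) (AdeleRing (𝓞 L) L)))) :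
            HA L e dV hdV dW hdW) ∈ 𝒦.K) :
    ∃ E₇ : ℂ → HA L e dV hdV dW hdW → ℂ,
      (∀ h : HA L e dV hdV dW hdW, DifferentiableOn ℂ (fun s => E₇ s h) {s : ℂ | 0 < s.re}) ∧
      (∀ s : ℂ, 0 < s.re → Continuous (E₇ s)) ∧
      (∀ (s : ℂ) (h : HA L e dV hdV dW hdW), ((2 : ℕ) : ℝ) / 2 < s.re →
        E₇ s h = (∏ p ∈ ({(1 / 2 : ℂ)} : Finset ℂ), (s - p)) * ∫ u, (β u).toReal •
        (∑' q : ↥(({Quotient.mk (MulAction.orbitRel (siegelDeltaRat L e dV hdV dW hdW) (ratH L e dV hdV dW hdW)) 1} ∪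
            Set.range (fun ν : unipDeltaRat L e dV hdV dW hdW =>
              (Quotient.mk (MulAction.orbitRel (siegelDeltaRat L e dV hdV dW hdW) (ratH L e dV hdV dW hdW)) (wq ν) :
                SiegelDeltaQuot L e dV hdV dW hdW)))ᶜ : Set (SiegelDeltaQuot L e dV hdV dW hdW)),
          f s ((((Quotient.out (q : SiegelDeltaQuot L e dV hdV dW hdW) : ratH L e dV hdV dW hdW) : HA L e dV hdV dW hdW)) *
            ((u : HA L e dV hdV dW hdW) * h))) ∂νN) ∧
      (∀ z : ℂ, 0 < z.re → ∃ C A r : ℝ, 0 < r ∧ ∀ s : ℂ, dist s z < r → ∀ h : HA L e dV hdV dW hdW,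
        ‖E₇ s h‖ ≤ C * adelicHeightGL (2 + 2) L (h : GL (Fin (2 + 2)) (AdeleRing (𝓞 L) L)) ^ A) := by
  -- the constructible datum (★ p862830)
  obtain ⟨g₀, Λ, Γ₀, β₁, F, hg₀, hΛc, hΛ, hΓ₀, hβ₁, hF⟩ := exists_middleTerm_datum L e dV hdV dW hdW hdV0 hdW0 νN f
  -- the preimage level from archimedean adaptedness (★ p862786)
  obtain ⟨KG, hKGo, hKGfi, hΛK⟩ := exists_preimageLevel L e dV hdV dW hdW h𝒦 Λ hΛc (hadapt Λ hΛ)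
  -- the analytic letters (★ p862873, orientation-free)
  obtain ⟨hint, hFhol⟩ := hint_and_hFhol_of_standard' L e dV hdV hdV0 dW hdW hdW0 hg₀ Λ hΛ Γ₀ hΓ₀ νN hβ₁ hχ 𝒦 f hstd hcont F hF
  -- ★ ED. 5
  exact exists_middleTerm_package_of_standard_level L e dV hdV dW hdW hg₀ Λ hΛ Γ₀ hΓ₀ wq hwq hdV0 hdW0 νN β hβ hβtop hK hβK hχ hχc 𝒦 h𝒦 f hstd hcont hΛc
    KG hKGo hKGfi hΛK hβ₁ F hF hint hFhol

end Summit.HodgeConjecture.HodgeConjecture.Cruxes.HLiu418.K2LiuSiegelEisensteinMiddleTermOfStandardArch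

end
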